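-- parent: WildSplitControlAtThree · glue (gen 1)
import Summits.BirchSwinnertonDyer.BirchSwinnertonDyer.Theses.UniversalToricDescent
import Literature.NumberTheory.EllipticCurves.Serre1967.PotentiallySupersingularNoStableLineProofs
import HarnessLib

/-!
# Route `UniversalToricDescent` — support leaf `SerrePotentiallySupersingularNoStableLineFact`
# (stmt-BirchSwinnertonDyer-20467): a tree THEOREM, by name

Seat `bsd-wall-utd-p3`, gen 5 (cell `bsd-wall`, lane 3 UTD). Leaf 7/7 of crux #5
`WildSplitControlAtThree`'s published-fact split: Serre 1967 (Driebergen) §5 Prop. 8 / Th. 4 in tree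
vocabulary — for `W/ℚ`, `p` with `ord_p j ≥ 0` and supersingular reduction at every good place above
`p` of every number field, `E(K̄)[p^∞]` contains no `D_𝔭`-stable `p`-divisible line with `#N[p] ≤ p` —
is now the tree theorem
`Literature.NumberTheory.EllipticCurves.Serre1967.noStableDivisibleLine_of_potentiallySupersingular_holds`
(module `Literature/NumberTheory/EllipticCurves/Serre1967/PotentiallySupersingularNoStableLineProofs`,
proved in the kernel this generation from the division-polynomial contraction on `E₁`, the
supersingular shape of `ψ_p²` at a good supersingular place, the degree/valuation bound over `K_v`,
potential good reduction and decomposition-group transport).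
HONEST FRAMING: one named-fact token of the UTD crux #5 input list is discharged; BSD is not
advanced by this beyond removing that hypothesis.

References: [Serre1967GroupesPDivisibles] §5 Prop. 8, Lemme 3, Th. 4; [SilvermanAEC2009] VII.§§1–3.
-/

set_option linter.dupNamespace false

namespace Summit.BirchSwinnertonDyer.BirchSwinnertonDyer.Theorems

open Summit.BirchSwinnertonDyer.BirchSwinnertonDyer.Theses.UniversalToricDescent

/-- **Leaf `SerrePotentiallySupersingularNoStableLineFact` (item 20467) holds**: the named fact
`Serre1967.noStableDivisibleLine_of_potentiallySupersingular` (Serre 1967 §5 Prop. 8 / Th. 4, LINE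
case: no Galois-stable `p`-divisible line in `E[p^∞]` at a place of potentially supersingular
reduction) is the tree theorem `noStableDivisibleLine_of_potentiallySupersingular_holds`.
[cite: Serre1967GroupesPDivisibles, §5 Prop. 8 and Th. 4] -/
theorem serrePotentiallySupersingularNoStableLineFact_proof :
    SerrePotentiallySupersingularNoStableLineFact := by
  unfold SerrePotentiallySupersingularNoStableLineFact
  exact Literature.NumberTheory.EllipticCurves.Serre1967.noStableDivisibleLine_of_potentiallySupersingular_holds

end Summit.BirchSwinnertonDyer.BirchSwinnertonDyer.Theorems
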